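import Summits.QuantumFields.BalabanUV.Beta.GAN24.WardRemainderEndThree
import Summits.QuantumFields.BalabanUV.Beta.GAN24.WardResidualSUnroll
import Summits.QuantumFields.BalabanUV.Beta.HessKerUnitsOnlyK

/-!
# `BalabanUV.Beta.GAN24.WardRemainderEndThreeSplit` — binder row G-an2-4 ∕ (CONV-C), W-slot CT-W, route «WC-TL» ∕ (Q-R) «QR-LL»: **THE ASSEMBLY «(Q-R)» IN THE
# SPLIT (SUB-LETTER) FORM — THE (LAY)∕(LT) ROWS DISPLAYED PER SUB-LABEL OF THE LABEL's `Lc`-BLOCK, IN leaf-01's `(L, y)` CELL CURRENCY VERBATIM, AND THE END's WEIGHT AT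
# THE LABEL's FINE POSITION `Lc•Y`** (row owner `b2b-balaban-gan24-p1`, gen 28; repair of the located lattice reading of leaf-03 g61 W-1, journal l.43016 — the OWNER's W15)

NOT IN PRINT; OUR BOOKKEEPING ([folklore] assembly BY NAME: the owner's `WardRemainderRows.wLocStencil_unitS_of_unrolled`, `WardRemainderTransportedLetter` §1–§2,
p2's `WardResidualSUnroll.sum_box_mul` (box nesting), leaf-01's `AffineUnroll.transport_sum` ∕ `SrecBornSector` class lemmas, an1's `KernelWard.biLoc_finset_sum`; 0 cited facts, 0 `def`, 0 `def … : Prop`, 0 sorry).  HONEST FRAMING (cell contract,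
verbatim): «discharging `BetaPertH` makes Bałaban's UV stability UNCONDITIONAL — a real constructive-QFT result; it is NOT the continuum limit and NOT the Clay problem.»
HONEST DEPENDENCY (verbatim): «continuum YM on T⁴ ⇐ BetaPertH ∧ nine spine estimates (0/9 proved); BetaPertH ⇐ (D1) ∧ (D4) ∧ CAP+tail; G-an2-4 gates asym, D1 and NE2/3/4.»

WHY.  `WardRemainderEndThree` (p327197 ✓) is TRUE as stated but its (LAY) displays `hS ∕ hω` read the END's label `Y ∈ Λ_{n+1}` as a slot-lattice point: the literal
level-`m` letter with label box `Lc^k•Y + box(Lc^k) ⊂ Λ_{m+2}` is supported near the FINE union `Lc^(k+1)•Y + box(Lc^(k+1)) ⊂ Λ_{m+1}`, one dilation away from the displayed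
face set — not instantiable with level-free constants for `k ≥ 1` (leaf-03 g61 W-1; confirmed by the owner, W15).  THIS FILE re-cuts the END with (i) the weight `e^{−η‖(Lc:ℤ)•Y − u‖₁}` (the label's fine position), (ii) the TRANSPORTED levels PER SUB-LETTER: for `v ∈ box Lc` the sub-letter
`T_{m,k,v} := unitS_{m+1}(Σ_{w∈box(Lc^k)} σ m (Lc^k•(Lc•Y + toSite v) + toSite w))` is a ONE-`L`-BLOCK letter (`L = Lc^(k+1)`, Λ_n-label `y_v = Lc•Y + toSite v`) and its rows
`hff ∕ hS ∕ hω` and the layer bound `hLT` are displayed in leaf-01's `(L, y_v)` cell currency VERBATIM, the END summing the `Lc^{d+1}` sub-letters (`biLoc_finset_sum`) under a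
PROVED additivity of the (REP) transport in units over the sub-letters (§1b `transport_unitS_blockSum_split`: box nesting `sum_box_mul` + `AffineUnroll.transport_sum` on the
class of local stencil families + `unitS_transport_stepMap` + the inverse units — NO extra display: each sub-letter's class membership follows from its own (LAY) rows),
(iii) the UNTRANSPORTED level (`k = 0`) under the faces of the ONE `Lc`-block `Lc•Y + box Lc` (`biLoc_of_profile_block`).

WHAT.  §1 `l1_toSite_le`, `l1_unitVec_sub_toSite_le`, `faceWeight_block_le` (faces of one `L`-block of label `y` ⇒ `≤ (d+1)·2·#box·e^{δ((d+1)L+1)}·e^{−δ‖L•y − u‖₁}`), **`biLoc_of_profile_block`**;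
§1b `isLoc_of_isLoc_unitS` (asym1's `HessKerUnitsOnlyK.unitS_inv_unitS`), **`transport_unitStepMap_unitS_finset_sum`**, **`transport_unitS_blockSum_split`**;
§2 **`wLocStencil_unitS_of_layer_split`** (generic `d`, ratio `θ ∈ [0,1)`): (REP) `hunroll ∕ hΦ0`; (LAY) `hS0 ∕ hω0` (k = 0, blocking `Lc`), `hff ∕ hS ∕ hω` per
`(m, k, v)` at `(L = Lc^(k+1), y_v)`; (LT) `hLT` per `(m, k, v)` with weight `e^{−η‖y_v − U‖₁}` ⊢ `∀ κ′ u, BiLoc (unitS_n (Φ n Y) κ′ u) u u ((C₀ + C·(1 − θ)⁻¹)·e^{−η‖(Lc:ℤ)•Y − u‖₁}) (κ∕4)`,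
`C = #box(Lc)·e^{δ((d+1)Lc+1)}·(K + Cs·(d+1)·2·#box(Lc))` — level-free; §3 **`wLocStencil_unitS_split_three`** (`d = 3`, `θ = (√Lc)⁻¹`, `hLT` in the currency `K·(√(Lc^(k+1)))⁻¹`).
Discharges NOTHING of (Q-R) ∕ (LT) ∕ (LAY) ∕ (S) by itself; NEVER «G-an2-4 closed» as (CONV-C); NOT D1, NOT `BetaPertH`, NOT continuum, NOT Clay.  2026-08-22.
-/

noncomputable section

open Finset
open scoped BigOperators
open Literature.MathematicalPhysics.QuantumFieldTheory
open Literature.MathematicalPhysics.QuantumFieldTheory.Balaban1983to89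
open Literature.MathematicalPhysics.QuantumFieldTheory.Balaban1983to89.Beta
open B12Sec2to5 (l1 l1_nonneg)
open B6BondElimination (unitVec)
open ExpKernelCalculus (MKer Site BiLoc l1_sub_triangle l1_sub_symm)
open KernelWard (biLoc_finset_sum)
open OneStepResolventKernel (Fib LocStencil)
open OneStepKernelFamily (KInvStep)
open LatticeForm (quo)
open AffineAveraging (box toSite)
open BalabanStepJetsSucc (wE)
open StepJetData (biLoc_weaken l1_unitVec)
open Summit.QuantumFields.BalabanUV.Beta.SpineRooted (e3OfK)
open Summit.QuantumFields.BalabanUV.Beta.AxialDressingRooted (coDressKBmAt)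
open Summit.QuantumFields.BalabanUV.Beta.HessKerDressedUnits (unitS locStencil_unitS)
open Summit.QuantumFields.BalabanUV.Beta.HessKerUnitsOnlyK (unitS_inv_unitS)
open Summit.QuantumFields.BalabanUV.Beta.GAN24.CombesThomas (sfStep smStep sfStep_ne_zero smStep_ne_zero)
open Summit.QuantumFields.BalabanUV.Beta.GAN24.Push4 (IsFF)
open Summit.QuantumFields.BalabanUV.Beta.GAN24.Push4Iter (legChain)
open Summit.QuantumFields.BalabanUV.Beta.GAN24.Push3 (push₃)
open Summit.QuantumFields.BalabanUV.Beta.GAN24.RespStepBmDecompExact (respStepBmSeq)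
open Summit.QuantumFields.BalabanUV.Beta.GAN24.SrecBornSector (unitStepMap stepMap isLoc_zero isLoc_add isLoc_stepMap stepMap_add unitS_transport_stepMap)
open Summit.QuantumFields.BalabanUV.Beta.GAN24.AffineUnroll (transport transport_zero transport_sum)
open Summit.QuantumFields.BalabanUV.Beta.GAN24.WardResidualSUnroll (sum_box_mul)
open Summit.QuantumFields.BalabanUV.Beta.GAN24.WardResidualSUnits (unitS_finset_sum')
open Summit.QuantumFields.BalabanUV.Beta.GAN24.WardRemainderRows (wLocStencil_unitS_of_unrolled)
open Summit.QuantumFields.BalabanUV.Beta.GAN24.WardRemainderTransportedLetter (transport_unitStepMap_eq_cubic_push₃ locStencil_of_profile inv_sqrt_natCast_pow)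

namespace Summit.QuantumFields.BalabanUV.Beta.GAN24.WardRemainderEndThreeSplit

variable {d Lc : ℕ}

/-! ## §1 Faces of ONE block ⇒ a label weight at the block's base point -/

/-- [folklore] A box point has `ℓ¹`-norm at most `(d+1)·L`. -/
theorem l1_toSite_le {L : ℕ} {b : Fin (d + 1) → ℕ} (hb : b ∈ box (d + 1) L) : l1 (toSite b) ≤ ((d : ℝ) + 1) * (L : ℝ) := by
  unfold B12Sec2to5.l1
  have h : ∀ i, |((toSite b i : ℤ) : ℝ)| ≤ (L : ℝ) := fun i => by
    have hi : b i < L := by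
      have h' := hb; simp only [AffineAveraging.box, Fintype.mem_piFinset, Finset.mem_range] at h'; exact h' i
    rw [show ((toSite b i : ℤ) : ℝ) = ((b i : ℕ) : ℝ) by simp [toSite], abs_of_nonneg (by positivity)]
    exact_mod_cast hi.le
  calc (∑ i : Fin (d + 1), |((toSite b i : ℤ) : ℝ)|) ≤ ∑ _i : Fin (d + 1), (L : ℝ) := Finset.sum_le_sum fun i _ => h i
    _ = ((d : ℝ) + 1) * (L : ℝ) := by rw [Finset.sum_const, Finset.card_univ, Fintype.card_fin, nsmul_eq_mul]; push_cast; ring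

/-- [folklore] `‖e_μ − b‖₁ ≤ (d+1)·L + 1` for a box point `b`. -/
theorem l1_unitVec_sub_toSite_le {L : ℕ} (μ : Fin (d + 1)) {b : Fin (d + 1) → ℕ} (hb : b ∈ box (d + 1) L) :
    l1 ((unitVec μ : Fin (d + 1) → ℤ) - toSite b) ≤ ((d : ℝ) + 1) * (L : ℝ) + 1 := by
  have h1 := l1_sub_triangle (unitVec μ : Fin (d + 1) → ℤ) 0 (toSite b)
  rw [l1_sub_symm 0 (toSite b), sub_zero, sub_zero, l1_unitVec] at h1; linarith [l1_toSite_le (d := d) hb]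

/-- [folklore] **THE FACE WEIGHT OF ONE `L`-BLOCK IS A LABEL WEIGHT AT THE BLOCK's BASE POINT**: every face site of the block `L•y + box L` is within `ℓ¹`-distance `(d+1)L + 1` of
`L•y`, so the face weight is `≤ (d+1)·2·#box·e^{δ((d+1)L+1)}·e^{−δ‖L•y − u‖₁}`. -/
theorem faceWeight_block_le (L : ℕ) (y u : Fin (d + 1) → ℤ) {δ : ℝ} (hδ : 0 ≤ δ) :
    (∑ μ : Fin (d + 1),
      (∑ v ∈ ((box (d + 1) L).filter (fun v => v μ = L - 1)).image (fun v => (L : ℤ) • y + toSite v), Real.exp (-δ * l1 (v - u))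
        + ∑ v ∈ ((box (d + 1) L).filter (fun v => v μ = 0)).image (fun v => (L : ℤ) • y + toSite v - unitVec μ),
            Real.exp (-δ * l1 (v - u))))
      ≤ ((d : ℝ) + 1) * (2 * ((box (d + 1) L).card : ℝ)) * Real.exp (δ * (((d : ℝ) + 1) * L + 1)) * Real.exp (-δ * l1 ((L : ℤ) • y - u)) := by
  -- every face site `v` has `l1 (L•y − u) ≤ ((d+1)L + 1) + l1 (v − u)`
  have hb : ∀ μ : Fin (d + 1), ∀ v ∈ ((box (d + 1) L).filter (fun v => v μ = L - 1)).image (fun v => (L : ℤ) • y + toSite v)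
      ∪ ((box (d + 1) L).filter (fun v => v μ = 0)).image (fun v => (L : ℤ) • y + toSite v - unitVec μ),
      Real.exp (-δ * l1 (v - u)) ≤ Real.exp (δ * (((d : ℝ) + 1) * L + 1)) * Real.exp (-δ * l1 ((L : ℤ) • y - u)) := by
    intro μ v hv
    rw [← Real.exp_add]
    refine Real.exp_le_exp.2 ?_
    have hdist : l1 ((L : ℤ) • y - u) ≤ (((d : ℝ) + 1) * L + 1) + l1 (v - u) := by
      rcases Finset.mem_union.1 hv with h | h
      · obtain ⟨b, hb', rfl⟩ := Finset.mem_image.1 h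
        have h1 := l1_sub_triangle ((L : ℤ) • y) ((L : ℤ) • y + toSite b) u
        have h2 : l1 ((L : ℤ) • y - ((L : ℤ) • y + toSite b)) ≤ ((d : ℝ) + 1) * L := by
          rw [l1_sub_symm, show (L : ℤ) • y + toSite b - (L : ℤ) • y = toSite b by abel]
          exact l1_toSite_le (Finset.mem_filter.1 hb').1
        linarith
      · obtain ⟨b, hb', rfl⟩ := Finset.mem_image.1 h
        have h1 := l1_sub_triangle ((L : ℤ) • y) ((L : ℤ) • y + toSite b - unitVec μ) u
        have h2 : l1 ((L : ℤ) • y - ((L : ℤ) • y + toSite b - unitVec μ)) ≤ ((d : ℝ) + 1) * L + 1 := by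
          rw [show (L : ℤ) • y - ((L : ℤ) • y + toSite b - unitVec μ) = (unitVec μ : Fin (d + 1) → ℤ) - toSite b by abel]
          exact l1_unitVec_sub_toSite_le μ (Finset.mem_filter.1 hb').1
        linarith
    nlinarith
  have hsum : ∀ (s : Finset (Fin (d + 1) → ℤ)), (s.card : ℝ) ≤ ((box (d + 1) L).card : ℝ) →
      (∀ v ∈ s, Real.exp (-δ * l1 (v - u)) ≤ Real.exp (δ * (((d : ℝ) + 1) * L + 1)) * Real.exp (-δ * l1 ((L : ℤ) • y - u))) →
      (∑ v ∈ s, Real.exp (-δ * l1 (v - u))) ≤ ((box (d + 1) L).card : ℝ) * (Real.exp (δ * (((d : ℝ) + 1) * L + 1)) * Real.exp (-δ * l1 ((L : ℤ) • y - u))) := by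
    intro s hs hb'
    refine (Finset.sum_le_card_nsmul s (fun v => Real.exp (-δ * l1 (v - u))) _ hb').trans ?_
    rw [nsmul_eq_mul]
    exact mul_le_mul_of_nonneg_right hs (by positivity)
  calc (∑ μ : Fin (d + 1),
      (∑ v ∈ ((box (d + 1) L).filter (fun v => v μ = L - 1)).image (fun v => (L : ℤ) • y + toSite v), Real.exp (-δ * l1 (v - u))
        + ∑ v ∈ ((box (d + 1) L).filter (fun v => v μ = 0)).image (fun v => (L : ℤ) • y + toSite v - unitVec μ),
            Real.exp (-δ * l1 (v - u))))
      ≤ ∑ _μ : Fin (d + 1), 2 * (((box (d + 1) L).card : ℝ) * (Real.exp (δ * (((d : ℝ) + 1) * L + 1)) * Real.exp (-δ * l1 ((L : ℤ) • y - u)))) :=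
        Finset.sum_le_sum fun μ _ => by
          have h1 := hsum _ (by exact_mod_cast Finset.card_image_le.trans (Finset.card_filter_le _ _)) fun v hv => hb μ v (Finset.mem_union.2 (Or.inl hv))
          have h2 := hsum _ (by exact_mod_cast Finset.card_image_le.trans (Finset.card_filter_le _ _)) fun v hv => hb μ v (Finset.mem_union.2 (Or.inr hv))
          linarith
    _ = ((d : ℝ) + 1) * (2 * ((box (d + 1) L).card : ℝ)) * Real.exp (δ * (((d : ℝ) + 1) * L + 1)) * Real.exp (-δ * l1 ((L : ℤ) • y - u)) := by
        rw [Finset.sum_const, Finset.card_univ, Fintype.card_fin, nsmul_eq_mul]; push_cast; ring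

/-- NOT IN PRINT; OUR BOOKKEEPING.  **A LETTER UNDER THE FACE WEIGHT OF ONE `L`-BLOCK OF LABEL `y` IS LABEL-LOCALISED AT `L•y`**: `BiLoc (S k u) u u (Cs·(d+1)·2·#box·e^{δ((d+1)L+1)}·e^{−η‖L•y − u‖₁}) r`
for every `η ≤ δ`, `r ≤ m` — the untransported level of the split END (`L = Lc`, `y = Y`). -/
theorem biLoc_of_profile_block {S : Fin (d + 1) → (Fin (d + 1) → ℤ) → MKer (d + 1) (Fib d)} {ω : (Fin (d + 1) → ℤ) → ℝ} {Cs m δ η r : ℝ}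
    (hCs : 0 ≤ Cs) (hδ : 0 ≤ δ) (hηδ : η ≤ δ) (hrm : r ≤ m)
    (hS : ∀ k u x z a b, |S k u x z a b| ≤ Cs * ω u * Real.exp (-m * (l1 (x - u) + l1 (z - u))))
    (L : ℕ) (y : Fin (d + 1) → ℤ)
    (hω : ∀ u, 0 ≤ ω u ∧ ω u ≤ ∑ μ : Fin (d + 1),
      (∑ v ∈ ((box (d + 1) L).filter (fun v => v μ = L - 1)).image (fun v => (L : ℤ) • y + toSite v), Real.exp (-δ * l1 (v - u))
        + ∑ v ∈ ((box (d + 1) L).filter (fun v => v μ = 0)).image (fun v => (L : ℤ) • y + toSite v - unitVec μ),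
            Real.exp (-δ * l1 (v - u))))
    (k : Fin (d + 1)) (u : Fin (d + 1) → ℤ) :
    BiLoc (S k u) u u (Cs * (((d : ℝ) + 1) * (2 * ((box (d + 1) L).card : ℝ)) * Real.exp (δ * (((d : ℝ) + 1) * L + 1))) * Real.exp (-η * l1 ((L : ℤ) • y - u))) r := by
  have h1 : BiLoc (S k u) u u (Cs * (((d : ℝ) + 1) * (2 * ((box (d + 1) L).card : ℝ)) * Real.exp (δ * (((d : ℝ) + 1) * L + 1))) * Real.exp (-η * l1 ((L : ℤ) • y - u))) m := by
    intro x z a b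
    refine (hS k u x z a b).trans ?_
    have hω' := (hω u).2.trans (faceWeight_block_le L y u hδ)
    have hηe : Real.exp (-δ * l1 ((L : ℤ) • y - u)) ≤ Real.exp (-η * l1 ((L : ℤ) • y - u)) := Real.exp_le_exp.2 (by nlinarith [l1_nonneg ((L : ℤ) • y - u)])
    have he : 0 ≤ Real.exp (-m * (l1 (x - u) + l1 (z - u))) := (Real.exp_pos _).le
    have hp : 0 ≤ ((d : ℝ) + 1) * (2 * ((box (d + 1) L).card : ℝ)) * Real.exp (δ * (((d : ℝ) + 1) * L + 1)) := by positivity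
    have hω'' : ω u ≤ ((d : ℝ) + 1) * (2 * ((box (d + 1) L).card : ℝ)) * Real.exp (δ * (((d : ℝ) + 1) * L + 1)) * Real.exp (-η * l1 ((L : ℤ) • y - u)) :=
      hω'.trans (mul_le_mul_of_nonneg_left hηe hp)
    nlinarith [mul_le_mul_of_nonneg_left hω'' hCs]
  exact biLoc_weaken h1 le_rfl hrm

/-! ## §1b The (REP) transport in units is additive over finite sums of local tables — the sub-letter split is a THEOREM -/

/-- [folklore] A table is in the class of local stencil families (at SOME positive rate) iff its unit rescaling is: the backward direction. -/
theorem isLoc_of_isLoc_unitS {sf sm : ℝ} (hsf : sf ≠ 0) (hsm : sm ≠ 0) {S : Fin (d + 1) → (Fin (d + 1) → ℤ) → MKer (d + 1) (Fib d)}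
    (h : ∃ Cs δ : ℝ, 0 < δ ∧ LocStencil (unitS sf sm S) Cs δ) : ∃ Cs δ : ℝ, 0 < δ ∧ LocStencil S Cs δ := by
  obtain ⟨Cs, δ, hδ, hl⟩ := h
  have h2 := locStencil_unitS (sf := sf⁻¹) (sm := sm⁻¹) hl
  rw [unitS_inv_unitS hsf hsm S] at h2
  exact ⟨_, δ, hδ, h2⟩

section Split

variable [NeZero Lc]

/-- [folklore] **THE (REP) TRANSPORT IN UNITS IS ADDITIVE OVER FINITE SUMS OF LOCAL TABLES** (in-block root): `unitS_transport_stepMap` (units commute with the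
transport), `AffineUnroll.transport_sum` on the class of local stencil families (`isLoc_zero ∕ isLoc_add ∕ isLoc_stepMap ∕ stepMap_add`), `unitS_finset_sum'`. -/
theorem transport_unitStepMap_unitS_finset_sum {rr : Fin (d + 1) → ℕ} (hrr : rr ∈ box (d + 1) Lc) (cE : ℝ) {ι : Type*} (s : Finset ι) (m k : ℕ)
    (g : ι → Fin (d + 1) → (Fin (d + 1) → ℤ) → MKer (d + 1) (Fib d)) (hg : ∀ i ∈ s, ∃ Cs δ : ℝ, 0 < δ ∧ LocStencil (g i) Cs δ) :
    transport (unitStepMap Lc (toSite rr) cE) m k (unitS (sfStep Lc m) (smStep d Lc m) (∑ i ∈ s, g i))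
      = ∑ i ∈ s, transport (unitStepMap Lc (toSite rr) cE) m k (unitS (sfStep Lc m) (smStep d Lc m) (g i)) := by
  rw [← unitS_transport_stepMap (toSite rr) cE m _ k,
    transport_sum (P := fun S : Fin (d + 1) → (Fin (d + 1) → ℤ) → MKer (d + 1) (Fib d) => ∃ Cs δ : ℝ, 0 < δ ∧ LocStencil S Cs δ)
      isLoc_zero (fun _ _ h h' => isLoc_add h h') (fun j _ h => isLoc_stepMap hrr cE j h) (fun j _ _ h h' => stepMap_add hrr cE j h h') m k s g hg,
    unitS_finset_sum']
  exact Finset.sum_congr rfl fun i _ => unitS_transport_stepMap (toSite rr) cE m (g i) k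

/-- NOT IN PRINT; OUR BOOKKEEPING.  **THE SUB-LETTER SPLIT**: the transported block sum of a letter family over the `Lc^(k+1)`-block of label `Y` is the sum over
`v ∈ box Lc` of the transported block sums over the `Lc^k`-blocks of the sub-labels `y_v = Lc•Y + v` (`sum_box_mul` + additivity; sub-letter sums in the class). -/
theorem transport_unitS_blockSum_split {rr : Fin (d + 1) → ℕ} (hrr : rr ∈ box (d + 1) Lc) (cE : ℝ) (m k : ℕ) (Y : Fin (d + 1) → ℤ)
    (F : (Fin (d + 1) → ℤ) → Fin (d + 1) → (Fin (d + 1) → ℤ) → MKer (d + 1) (Fib d))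
    (hl : ∀ v ∈ box (d + 1) Lc, ∃ Cs δ : ℝ, 0 < δ ∧
      LocStencil (∑ w ∈ box (d + 1) (Lc ^ k), F (((Lc ^ k : ℕ) : ℤ) • (((Lc : ℕ) : ℤ) • Y + toSite v) + toSite w)) Cs δ) :
    transport (unitStepMap Lc (toSite rr) cE) (m + 1) (k + 1)
        (unitS (sfStep Lc (m + 1)) (smStep d Lc (m + 1)) (∑ w ∈ box (d + 1) (Lc ^ (k + 1)), F (((Lc ^ (k + 1) : ℕ) : ℤ) • Y + toSite w)))
      = ∑ v ∈ box (d + 1) Lc, transport (unitStepMap Lc (toSite rr) cE) (m + 1) (k + 1)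
        (unitS (sfStep Lc (m + 1)) (smStep d Lc (m + 1))
          (∑ w ∈ box (d + 1) (Lc ^ k), F (((Lc ^ k : ℕ) : ℤ) • (((Lc : ℕ) : ℤ) • Y + toSite v) + toSite w))) := by
  have hM : 1 ≤ Lc ^ k := Nat.one_le_pow _ _ (Nat.pos_of_ne_zero (NeZero.ne Lc))
  rw [pow_succ, sum_box_mul hM Lc F Y]
  exact transport_unitStepMap_unitS_finset_sum hrr cE (box (d + 1) Lc) (m + 1) (k + 1) _ hl

/-! ## §2 THE SPLIT END -/

/-- NOT IN PRINT; OUR BOOKKEEPING.  **THE ASSEMBLY «(Q-R)», SPLIT (SUB-LETTER) FORM, generic `d`, ratio `θ ∈ [0,1)`.**  As `WardRemainderEndThree.wLocStencil_unitS_of_layer`, with: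
the END weight at the label's FINE position `(Lc:ℤ)•Y`; the untransported level under the faces of the `Lc`-block of `Y` (`hS0 ∕ hω0`); the transported levels PER SUB-LETTER
`T_{m,k,v} = unitS_{m+1}(Σ_{w∈box(Lc^k)} σ m (Lc^k•(Lc•Y + toSite v) + toSite w))`, `v ∈ box Lc` — a ONE-`L`-block letter, `L = Lc^(k+1)`, Λ_n-label `y_v = Lc•Y + toSite v` — with
`hff ∕ hS ∕ hω` and the layer bound `hLT` (weight `e^{−η‖y_v − U‖₁}`) displayed in leaf-01's `(L, y_v)` cell currency; the (REP) transport's additivity over the sub-letters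
is PROVED (§1b), each sub-letter's class membership read off its own `hS ∕ hω`.  Conclusion:
`BiLoc (unitS_n (Φ n Y) κ′ u) u u ((C₀ + #box(Lc)·e^{δ((d+1)Lc+1)}·(K + Cs·(d+1)·2·#box(Lc))·(1 − θ)⁻¹)·e^{−min(κ∕2,δ∕2)‖Lc•Y − u‖₁}) (κ∕4)` — UNIFORM IN `n`. -/
theorem wLocStencil_unitS_of_layer_split {rr : Fin (d + 1) → ℕ} (hrr : rr ∈ box (d + 1) Lc)
    {Φ σ : ℕ → (Fin (d + 1) → ℤ) → Fin (d + 1) → (Fin (d + 1) → ℤ) → MKer (d + 1) (Fib d)} (n : ℕ) (Y : Fin (d + 1) → ℤ)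
    {ω0 : ℕ → (Fin (d + 1) → ℤ) → ℝ} {ω : ℕ → (Fin (d + 1) → ℕ) → (Fin (d + 1) → ℤ) → ℝ} {Cs κ m' δ K C₀ θ : ℝ}
    (hκ : 0 < κ) (hm : κ < m') (hδ : 0 < δ) (hCs : 0 ≤ Cs) (hK : 0 ≤ K) (hθ0 : 0 ≤ θ) (hθ1 : θ < 1)
    (hunroll : Φ n Y =
      transport (fun j (S : Fin (d + 1) → (Fin (d + 1) → ℤ) → MKer (d + 1) (Fib d)) =>
          fun κ' u' => ((Lc : ℝ) ^ (d + 1) * wE d Lc (j + 1)) • e3OfK Lc (coDressKBmAt (toSite rr) Lc (KInvStep (d := d) Lc j)) S κ' u') 0 n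
          (∑ w ∈ box (d + 1) (Lc ^ n), Φ 0 (((Lc ^ n : ℕ) : ℤ) • Y + toSite w))
      + ∑ m ∈ Finset.range n,
          transport (fun j (S : Fin (d + 1) → (Fin (d + 1) → ℤ) → MKer (d + 1) (Fib d)) =>
              fun κ' u' => ((Lc : ℝ) ^ (d + 1) * wE d Lc (j + 1)) • e3OfK Lc (coDressKBmAt (toSite rr) Lc (KInvStep (d := d) Lc j)) S κ' u') (m + 1) (n - 1 - m)
            (∑ w ∈ box (d + 1) (Lc ^ (n - 1 - m)), σ m (((Lc ^ (n - 1 - m) : ℕ) : ℤ) • Y + toSite w)))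
    (hΦ0 : ∀ κ' u, BiLoc (transport (unitStepMap Lc (toSite rr) ((Lc : ℝ) ^ (d + 1))) 0 n
          (unitS (sfStep Lc 0) (smStep d Lc 0) (∑ w ∈ box (d + 1) (Lc ^ n), Φ 0 (((Lc ^ n : ℕ) : ℤ) • Y + toSite w))) κ' u) u u
          (C₀ * Real.exp (-(min (κ / 2) (δ / 2)) * l1 (((Lc : ℕ) : ℤ) • Y - u))) (κ / 4))
    -- the untransported level: profile under the faces of the `Lc`-block of `Y`
    (hS0 : ∀ m, m + 1 = n → ∀ k' u x z a b, |unitS (sfStep Lc (m + 1)) (smStep d Lc (m + 1))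
        (∑ w ∈ box (d + 1) (Lc ^ 0), σ m (((Lc ^ 0 : ℕ) : ℤ) • Y + toSite w)) k' u x z a b| ≤ Cs * ω0 m u * Real.exp (-m' * (l1 (x - u) + l1 (z - u))))
    (hω0 : ∀ m, m + 1 = n → ∀ u, 0 ≤ ω0 m u ∧ ω0 m u ≤ ∑ μ : Fin (d + 1),
      (∑ v ∈ ((box (d + 1) Lc).filter (fun v => v μ = Lc - 1)).image (fun v => (Lc : ℤ) • Y + toSite v), Real.exp (-δ * l1 (v - u))
        + ∑ v ∈ ((box (d + 1) Lc).filter (fun v => v μ = 0)).image (fun v => (Lc : ℤ) • Y + toSite v - unitVec μ), Real.exp (-δ * l1 (v - u))))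
    -- per sub-letter: ff-valued, profile under the faces of its ONE `Lc^(k+1)`-block of label `y_v = Lc•Y + v`
    (hff : ∀ m k, m + k + 2 = n → ∀ v ∈ box (d + 1) Lc, ∀ κ' u, IsFF (unitS (sfStep Lc (m + 1)) (smStep d Lc (m + 1))
        (∑ w ∈ box (d + 1) (Lc ^ k), σ m (((Lc ^ k : ℕ) : ℤ) • (((Lc : ℕ) : ℤ) • Y + toSite v) + toSite w)) κ' u))
    (hS : ∀ m k, m + k + 2 = n → ∀ v ∈ box (d + 1) Lc, ∀ k' u x z a b, |unitS (sfStep Lc (m + 1)) (smStep d Lc (m + 1))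
        (∑ w ∈ box (d + 1) (Lc ^ k), σ m (((Lc ^ k : ℕ) : ℤ) • (((Lc : ℕ) : ℤ) • Y + toSite v) + toSite w)) k' u x z a b|
      ≤ Cs * ω m v u * Real.exp (-m' * (l1 (x - u) + l1 (z - u))))
    (hω : ∀ m k, m + k + 2 = n → ∀ v ∈ box (d + 1) Lc, ∀ u, 0 ≤ ω m v u ∧ ω m v u ≤ ∑ μ : Fin (d + 1),
      (∑ b ∈ ((box (d + 1) (Lc ^ (k + 1))).filter (fun b => b μ = Lc ^ (k + 1) - 1)).image
          (fun b => ((Lc ^ (k + 1) : ℕ) : ℤ) • (((Lc : ℕ) : ℤ) • Y + toSite v) + toSite b), Real.exp (-δ * l1 (b - u))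
        + ∑ b ∈ ((box (d + 1) (Lc ^ (k + 1))).filter (fun b => b μ = 0)).image
          (fun b => ((Lc ^ (k + 1) : ℕ) : ℤ) • (((Lc : ℕ) : ℤ) • Y + toSite v) + toSite b - unitVec μ), Real.exp (-δ * l1 (b - u))))
    -- per sub-letter: the layer bound in leaf-01's `(L = Lc^(k+1), y_v)` currency
    (hLT : ∀ m k, m + k + 2 = n → ∀ v ∈ box (d + 1) Lc, ∀ ν U, BiLoc (((((Lc ^ (k + 1) : ℕ) : ℝ)) ^ (3 * (d + 1))) •
        push₃ (legChain (respStepBmSeq (toSite rr) Lc) (m + 1) k) (legChain (respStepBmSeq (toSite rr) Lc) (m + 1) k) (legChain (respStepBmSeq (toSite rr) Lc) (m + 1) k)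
          (unitS (sfStep Lc (m + 1)) (smStep d Lc (m + 1))
            (∑ w ∈ box (d + 1) (Lc ^ k), σ m (((Lc ^ k : ℕ) : ℤ) • (((Lc : ℕ) : ℤ) • Y + toSite v) + toSite w))) ν U) U U
        (K * θ ^ (k + 1) * Real.exp (-(min (κ / 2) (δ / 2)) * l1 ((((Lc : ℕ) : ℤ) • Y + toSite v) - U))) (κ / 4)) :
    ∀ κ' u, BiLoc (unitS (sfStep Lc n) (smStep d Lc n) (Φ n Y) κ' u) u u
      ((C₀ + (((box (d + 1) Lc).card : ℝ) * Real.exp (δ * (((d : ℝ) + 1) * Lc + 1)) * (K + Cs * (((d : ℝ) + 1) * (2 * ((box (d + 1) Lc).card : ℝ)))))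
        * (1 - θ)⁻¹) * Real.exp (-(min (κ / 2) (δ / 2)) * l1 (((Lc : ℕ) : ℤ) • Y - u))) (κ / 4) := by
  set η : ℝ := min (κ / 2) (δ / 2) with hη
  have hη0 : 0 ≤ η := le_min (by linarith) (by linarith)
  have hηδ : η ≤ δ := (min_le_right _ _).trans (by linarith)
  set B : ℝ := ((box (d + 1) Lc).card : ℝ) with hB
  set E : ℝ := Real.exp (δ * (((d : ℝ) + 1) * Lc + 1)) with hE
  have hB0 : 0 ≤ B := by rw [hB]; positivity
  have hE1 : 1 ≤ E := by rw [hE]; exact Real.one_le_exp (by positivity)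
  have hK1 : 0 ≤ Cs * (((d : ℝ) + 1) * (2 * B)) := by positivity
  have hC : 0 ≤ B * E * (K + Cs * (((d : ℝ) + 1) * (2 * B))) := by positivity
  refine wLocStencil_unitS_of_unrolled (d := d) (fun _ u => Real.exp (-η * l1 (((Lc : ℕ) : ℤ) • Y - u))) (fun _ u => (Real.exp_pos _).le)
    hθ0 hθ1 hC (toSite rr) n Y hunroll hΦ0 ?_
  intro m hmr κ' u
  have he0 : 0 ≤ Real.exp (-η * l1 (((Lc : ℕ) : ℤ) • Y - u)) := (Real.exp_pos _).le
  obtain ⟨k, hk⟩ : ∃ k, n - 1 - m = k := ⟨_, rfl⟩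
  rw [hk]; rcases k with _ | k
  · -- the untransported level `m = n − 1`: faces of the `Lc`-block of `Y`
    have hmk : m + 1 = n := by have := Finset.mem_range.1 hmr; omega
    have h := biLoc_of_profile_block hCs hδ.le hηδ (r := κ / 4) (by linarith) (hS0 m hmk) Lc Y (hω0 m hmk) κ' u
    rw [transport_zero]
    refine biLoc_weaken h ?_ le_rfl
    show _ ≤ B * E * (K + Cs * (((d : ℝ) + 1) * (2 * B))) * θ ^ 0 * Real.exp (-η * l1 (((Lc : ℕ) : ℤ) • Y - u))
    rw [pow_zero, mul_one]
    have h1 : Cs * (((d : ℝ) + 1) * (2 * B) * E) ≤ B * E * (K + Cs * (((d : ℝ) + 1) * (2 * B))) := by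
      have hB1 : 1 ≤ B := by rw [hB]; exact_mod_cast Finset.card_pos.2 ⟨rr, hrr⟩
      nlinarith [mul_nonneg hB0 (mul_nonneg (by positivity : (0:ℝ) ≤ E) hK), mul_nonneg hK1 (by positivity : (0:ℝ) ≤ E)]
    nlinarith
  · -- `k + 1 ≥ 1` transported levels: split into the `#box(Lc)` sub-letters, each ONE cubic push bounded by `hLT`
    have hmk2 : m + k + 2 = n := by have := Finset.mem_range.1 hmr; omega
    -- the sub-letter split (§1b): each raw sub-letter sum is in the class, by its displayed unit profile and the inverse units
    have hl : ∀ v ∈ box (d + 1) Lc, ∃ Cs' δ' : ℝ, 0 < δ' ∧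
        LocStencil (∑ w ∈ box (d + 1) (Lc ^ k), σ m (((Lc ^ k : ℕ) : ℤ) • (((Lc : ℕ) : ℤ) • Y + toSite v) + toSite w)) Cs' δ' := fun v hv =>
      isLoc_of_isLoc_unitS (sfStep_ne_zero (m + 1)) (smStep_ne_zero (d := d) (m + 1))
        ⟨_, _, hκ.trans hm, locStencil_of_profile hCs hδ.le (hS m k hmk2 v hv) _ (hω m k hmk2 v hv)⟩
    rw [transport_unitS_blockSum_split hrr _ m k Y (σ m) hl]
    -- each sub-letter's transport, rewritten as the cubic push and bounded
    have hterm : ∀ v ∈ box (d + 1) Lc, BiLoc (transport (unitStepMap Lc (toSite rr) ((Lc : ℝ) ^ (d + 1))) (m + 1) (k + 1)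
        (unitS (sfStep Lc (m + 1)) (smStep d Lc (m + 1))
          (∑ w ∈ box (d + 1) (Lc ^ k), σ m (((Lc ^ k : ℕ) : ℤ) • (((Lc : ℕ) : ℤ) • Y + toSite v) + toSite w))) κ' u) u u
        (K * θ ^ (k + 1) * E * Real.exp (-η * l1 (((Lc : ℕ) : ℤ) • Y - u))) (κ / 4) := by
      intro v hv
      have hSl := locStencil_of_profile hCs hδ.le (hS m k hmk2 v hv) _ (hω m k hmk2 v hv)
      have h := hLT m k hmk2 v hv κ' u
      intro x z a b
      rw [transport_unitStepMap_eq_cubic_push₃ hrr (m + 1) k (hff m k hmk2 v hv) ⟨_, _, hκ.trans hm, hSl⟩ κ' u]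
      refine (h x z a b).trans (mul_le_mul_of_nonneg_right ?_ (Real.exp_pos _).le)
      -- `e^{−η‖y_v − u‖₁} ≤ E·e^{−η‖Lc•Y − u‖₁}` since `‖Lc•Y − u‖₁ ≤ ‖y_v − u‖₁ + (d+1)Lc`
      have hdist : l1 (((Lc : ℕ) : ℤ) • Y - u) ≤ l1 ((((Lc : ℕ) : ℤ) • Y + toSite v) - u) + (((d : ℝ) + 1) * Lc + 1) := by
        have h1 := l1_sub_triangle (((Lc : ℕ) : ℤ) • Y) (((Lc : ℕ) : ℤ) • Y + toSite v) u
        have h2 : l1 (((Lc : ℕ) : ℤ) • Y - (((Lc : ℕ) : ℤ) • Y + toSite v)) ≤ ((d : ℝ) + 1) * Lc := by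
          rw [l1_sub_symm, show ((Lc : ℕ) : ℤ) • Y + toSite v - ((Lc : ℕ) : ℤ) • Y = toSite v by abel]
          exact l1_toSite_le hv
        linarith
      have hexp : Real.exp (-η * l1 ((((Lc : ℕ) : ℤ) • Y + toSite v) - u)) ≤ E * Real.exp (-η * l1 (((Lc : ℕ) : ℤ) • Y - u)) := by
        have h4 : Real.exp (η * (((d : ℝ) + 1) * Lc + 1)) ≤ E := by rw [hE]; exact Real.exp_le_exp.2 (by nlinarith [show (0:ℝ) ≤ ((d:ℝ)+1) * Lc + 1 by positivity])
        refine le_trans ?_ (mul_le_mul_of_nonneg_right h4 (Real.exp_pos _).le)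
        rw [← Real.exp_add]; exact Real.exp_le_exp.2 (by nlinarith)
      calc K * θ ^ (k + 1) * Real.exp (-η * l1 ((((Lc : ℕ) : ℤ) • Y + toSite v) - u)) ≤ K * θ ^ (k + 1) * (E * Real.exp (-η * l1 (((Lc : ℕ) : ℤ) • Y - u))) :=
            mul_le_mul_of_nonneg_left hexp (mul_nonneg hK (pow_nonneg hθ0 _))
        _ = K * θ ^ (k + 1) * E * Real.exp (-η * l1 (((Lc : ℕ) : ℤ) • Y - u)) := by ring
    have hsum := biLoc_finset_sum (box (d + 1) Lc) (p := u) (q := u) (δ := κ / 4)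
      (K := fun v => transport (unitStepMap Lc (toSite rr) ((Lc : ℝ) ^ (d + 1))) (m + 1) (k + 1)
        (unitS (sfStep Lc (m + 1)) (smStep d Lc (m + 1))
          (∑ w ∈ box (d + 1) (Lc ^ k), σ m (((Lc ^ k : ℕ) : ℤ) • (((Lc : ℕ) : ℤ) • Y + toSite v) + toSite w))) κ' u)
      (C := fun _ => K * θ ^ (k + 1) * E * Real.exp (-η * l1 (((Lc : ℕ) : ℤ) • Y - u))) hterm
    rw [Finset.sum_const, nsmul_eq_mul] at hsum
    rw [Finset.sum_apply, Finset.sum_apply]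
    refine biLoc_weaken hsum ?_ le_rfl
    show B * (K * θ ^ (k + 1) * E * Real.exp (-η * l1 (((Lc : ℕ) : ℤ) • Y - u)))
      ≤ B * E * (K + Cs * (((d : ℝ) + 1) * (2 * B))) * θ ^ (k + 1) * Real.exp (-η * l1 (((Lc : ℕ) : ℤ) • Y - u))
    have hθk : 0 ≤ θ ^ (k + 1) := pow_nonneg hθ0 _
    nlinarith [mul_nonneg (mul_nonneg (mul_nonneg hB0 (by positivity : (0:ℝ) ≤ E)) (mul_nonneg hK1 hθk)) he0]

/-! ## §3 `d = 3`: the literal-socket currency `K·(√(Lc^(k+1)))⁻¹` of leaf-01's ONE-BLOCK cell -/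

/-- NOT IN PRINT; OUR BOOKKEEPING.  **THE SPLIT END AT `d = 3`** — §2 with the ratio `θ = (√Lc)⁻¹` (`2 ≤ Lc`) and the per-sub-letter layer bound displayed in leaf-01's
literal-socket currency `K·((√(((Lc^(k+1):ℕ):ℝ)))⁻¹·e^{−η‖y_v − U‖₁})` — the parenthesisation of `LayerTransportLiteralSocket.exists_hLT_literal_of_gauge_cells`' conclusion, token-exact
(ONE `Lc^(k+1)`-block letter of Λ_n-label `y_v = Lc•Y + v`; `inv_sqrt_natCast_pow` + `mul_assoc`).
Constant `(C₀ + #box(Lc)·e^{δ(4Lc+1)}·(K + 8·#box(Lc)·Cs)·(1 − (√Lc)⁻¹)⁻¹)·e^{−η‖Lc•Y − u‖₁}` — UNIFORM IN `n`. -/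
theorem wLocStencil_unitS_split_three {rr : Fin (3 + 1) → ℕ} (hrr : rr ∈ box (3 + 1) Lc) (hLc : 2 ≤ Lc)
    {Φ σ : ℕ → (Fin (3 + 1) → ℤ) → Fin (3 + 1) → (Fin (3 + 1) → ℤ) → MKer (3 + 1) (Fib 3)} (n : ℕ) (Y : Fin (3 + 1) → ℤ)
    {ω0 : ℕ → (Fin (3 + 1) → ℤ) → ℝ} {ω : ℕ → (Fin (3 + 1) → ℕ) → (Fin (3 + 1) → ℤ) → ℝ} {Cs κ m' δ K C₀ : ℝ}
    (hκ : 0 < κ) (hm : κ < m') (hδ : 0 < δ) (hCs : 0 ≤ Cs) (hK : 0 ≤ K)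
    (hunroll : Φ n Y =
      transport (fun j (S : Fin (3 + 1) → (Fin (3 + 1) → ℤ) → MKer (3 + 1) (Fib 3)) =>
          fun κ' u' => ((Lc : ℝ) ^ (3 + 1) * wE 3 Lc (j + 1)) • e3OfK Lc (coDressKBmAt (toSite rr) Lc (KInvStep (d := 3) Lc j)) S κ' u') 0 n
          (∑ w ∈ box (3 + 1) (Lc ^ n), Φ 0 (((Lc ^ n : ℕ) : ℤ) • Y + toSite w))
      + ∑ m ∈ Finset.range n,
          transport (fun j (S : Fin (3 + 1) → (Fin (3 + 1) → ℤ) → MKer (3 + 1) (Fib 3)) =>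
              fun κ' u' => ((Lc : ℝ) ^ (3 + 1) * wE 3 Lc (j + 1)) • e3OfK Lc (coDressKBmAt (toSite rr) Lc (KInvStep (d := 3) Lc j)) S κ' u') (m + 1) (n - 1 - m)
            (∑ w ∈ box (3 + 1) (Lc ^ (n - 1 - m)), σ m (((Lc ^ (n - 1 - m) : ℕ) : ℤ) • Y + toSite w)))
    (hΦ0 : ∀ κ' u, BiLoc (transport (unitStepMap Lc (toSite rr) ((Lc : ℝ) ^ (3 + 1))) 0 n
          (unitS (sfStep Lc 0) (smStep 3 Lc 0) (∑ w ∈ box (3 + 1) (Lc ^ n), Φ 0 (((Lc ^ n : ℕ) : ℤ) • Y + toSite w))) κ' u) u u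
          (C₀ * Real.exp (-(min (κ / 2) (δ / 2)) * l1 (((Lc : ℕ) : ℤ) • Y - u))) (κ / 4))
    (hS0 : ∀ m, m + 1 = n → ∀ k' u x z a b, |unitS (sfStep Lc (m + 1)) (smStep 3 Lc (m + 1))
        (∑ w ∈ box (3 + 1) (Lc ^ 0), σ m (((Lc ^ 0 : ℕ) : ℤ) • Y + toSite w)) k' u x z a b| ≤ Cs * ω0 m u * Real.exp (-m' * (l1 (x - u) + l1 (z - u))))
    (hω0 : ∀ m, m + 1 = n → ∀ u, 0 ≤ ω0 m u ∧ ω0 m u ≤ ∑ μ : Fin (3 + 1),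
      (∑ v ∈ ((box (3 + 1) Lc).filter (fun v => v μ = Lc - 1)).image (fun v => (Lc : ℤ) • Y + toSite v), Real.exp (-δ * l1 (v - u))
        + ∑ v ∈ ((box (3 + 1) Lc).filter (fun v => v μ = 0)).image (fun v => (Lc : ℤ) • Y + toSite v - unitVec μ), Real.exp (-δ * l1 (v - u))))
    (hff : ∀ m k, m + k + 2 = n → ∀ v ∈ box (3 + 1) Lc, ∀ κ' u, IsFF (unitS (sfStep Lc (m + 1)) (smStep 3 Lc (m + 1))
        (∑ w ∈ box (3 + 1) (Lc ^ k), σ m (((Lc ^ k : ℕ) : ℤ) • (((Lc : ℕ) : ℤ) • Y + toSite v) + toSite w)) κ' u))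
    (hS : ∀ m k, m + k + 2 = n → ∀ v ∈ box (3 + 1) Lc, ∀ k' u x z a b, |unitS (sfStep Lc (m + 1)) (smStep 3 Lc (m + 1))
        (∑ w ∈ box (3 + 1) (Lc ^ k), σ m (((Lc ^ k : ℕ) : ℤ) • (((Lc : ℕ) : ℤ) • Y + toSite v) + toSite w)) k' u x z a b|
      ≤ Cs * ω m v u * Real.exp (-m' * (l1 (x - u) + l1 (z - u))))
    (hω : ∀ m k, m + k + 2 = n → ∀ v ∈ box (3 + 1) Lc, ∀ u, 0 ≤ ω m v u ∧ ω m v u ≤ ∑ μ : Fin (3 + 1),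
      (∑ b ∈ ((box (3 + 1) (Lc ^ (k + 1))).filter (fun b => b μ = Lc ^ (k + 1) - 1)).image
          (fun b => ((Lc ^ (k + 1) : ℕ) : ℤ) • (((Lc : ℕ) : ℤ) • Y + toSite v) + toSite b), Real.exp (-δ * l1 (b - u))
        + ∑ b ∈ ((box (3 + 1) (Lc ^ (k + 1))).filter (fun b => b μ = 0)).image
          (fun b => ((Lc ^ (k + 1) : ℕ) : ℤ) • (((Lc : ℕ) : ℤ) • Y + toSite v) + toSite b - unitVec μ), Real.exp (-δ * l1 (b - u))))
    -- per sub-letter: leaf-01's ONE-BLOCK cell in its literal-socket currency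
    (hLT : ∀ m k, m + k + 2 = n → ∀ v ∈ box (3 + 1) Lc, ∀ ν U, BiLoc (((((Lc ^ (k + 1) : ℕ) : ℝ)) ^ (3 * (3 + 1))) •
        push₃ (legChain (respStepBmSeq (toSite rr) Lc) (m + 1) k) (legChain (respStepBmSeq (toSite rr) Lc) (m + 1) k) (legChain (respStepBmSeq (toSite rr) Lc) (m + 1) k)
          (unitS (sfStep Lc (m + 1)) (smStep 3 Lc (m + 1))
            (∑ w ∈ box (3 + 1) (Lc ^ k), σ m (((Lc ^ k : ℕ) : ℤ) • (((Lc : ℕ) : ℤ) • Y + toSite v) + toSite w))) ν U) U U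
        (K * ((Real.sqrt (((Lc ^ (k + 1) : ℕ) : ℝ)))⁻¹ * Real.exp (-(min (κ / 2) (δ / 2)) * l1 ((((Lc : ℕ) : ℤ) • Y + toSite v) - U)))) (κ / 4)) :
    ∀ κ' u, BiLoc (unitS (sfStep Lc n) (smStep 3 Lc n) (Φ n Y) κ' u) u u
      ((C₀ + (((box (3 + 1) Lc).card : ℝ) * Real.exp (δ * (((3 : ℝ) + 1) * Lc + 1)) * (K + Cs * (((3 : ℝ) + 1) * (2 * ((box (3 + 1) Lc).card : ℝ)))))
        * (1 - (Real.sqrt (Lc : ℝ))⁻¹)⁻¹) * Real.exp (-(min (κ / 2) (δ / 2)) * l1 (((Lc : ℕ) : ℤ) • Y - u))) (κ / 4) := by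
  have hLc1 : (1 : ℝ) < (Lc : ℝ) := by exact_mod_cast hLc
  have hs1 : 1 < Real.sqrt (Lc : ℝ) := by
    rw [show (1 : ℝ) = Real.sqrt 1 from Real.sqrt_one.symm]
    exact Real.sqrt_lt_sqrt zero_le_one hLc1
  have e3 : ((3 : ℕ) : ℝ) = (3 : ℝ) := by norm_num
  have h := wLocStencil_unitS_of_layer_split hrr n Y hκ hm hδ hCs hK (inv_nonneg.2 (Real.sqrt_nonneg _)) (inv_lt_one_of_one_lt₀ hs1) hunroll hΦ0 hS0 hω0 hff hS hω
    fun m k hmk v hv ν U => by rw [← inv_sqrt_natCast_pow, mul_assoc]; exact hLT m k hmk v hv ν U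
  rw [e3] at h
  exact h

end Split

end Summit.QuantumFields.BalabanUV.Beta.GAN24.WardRemainderEndThreeSplit

end
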